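import Mathlib
import HarnessLib
import Summits.AtomisticToContinuum.Crystallization.Theses.FrustratedLawDichotomy
import Summits.AtomisticToContinuum.Crystallization.Theorems.FrustratedLawDichotomyHardCoreUpgrade
import Summits.AtomisticToContinuum.Crystallization.Theorems.FrustratedLawDichotomyNashForceBalance
import Summits.AtomisticToContinuum.Crystallization.Theorems.FrustratedLawDichotomyNashLocalStability

/-!
# Crux `PeriodicFrustratedLawGap` (stmt-AtomisticToContinuum-27624) — the δ-normalised and EQUILIBRIUM cuts, by name

Route `FrustratedLawDichotomy`, the SPECIAL-side crux `PeriodicFrustratedLawGap` (Φper): same hypotheses (a) hard core,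
(b) point-stationarity, (d) texture, (e) Nash as the residual `AperiodicFrustratedLawGap`, with the law charging periodic atom
sets.  The hand-1 consequences of (a), (d), (e) landed for the residual are hypothesis-level and apply verbatim:

* `periodicFrustratedLawGap_iff_sep07` — Φper (route decl, BY NAME) ⟺ its single instance `δ = 7/10` (texture forces a.s.
  `7/10` hard core, `FrustratedLawDichotomyHardCoreUpgrade.ae_isRootedHardCore_upgrade`);
* `periodicFrustratedLawGap_iff_equilibrium` — Φper ⟺ its restriction to `δ = 7/10` and to laws a.s. in FORCE BALANCE
  (`FrustratedLawDichotomyNashForceBalance.ae_forceBalance_of_nash`) and LOCALLY STABLE with near neighbours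
  (`FrustratedLawDichotomyNashLocalStability.ae_laplacian_nonneg_of_nash`, `ae_exists_near_of_nash`) at every atom.

So the periodic textured configurations `Q` to be excluded rung by rung are `7/10`-separated Lennard-Jones EQUILIBRIA,
Laplacian-stable at every site, with nearest-neighbour distance `≤ (11/5)^{1/6} ≈ 1.1404` at every site.
`[folklore]` (bookkeeping).
-/

noncomputable section

namespace Summit.AtomisticToContinuum.Crystallization.Theorems.FrustratedLawDichotomyPeriodicGapEquilibriumCut

open MeasureTheory
open Summit.AtomisticToContinuum.Crystallization.Theorems.FrustratedLawDichotomyHardCoreUpgrade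
  (ae_isRootedHardCore_upgrade)
open Summit.AtomisticToContinuum.Crystallization.Theorems.FrustratedLawDichotomyNashForceBalance
  (ae_forceBalance_of_nash)
open Summit.AtomisticToContinuum.Crystallization.Theorems.FrustratedLawDichotomyNashLocalStability
  (ae_laplacian_nonneg_of_nash ae_exists_near_of_nash)

/-- **δ-normalised cut for Φper.**  `PeriodicFrustratedLawGap` (BY NAME) is EQUIVALENT to its instance `δ = 7/10`: the
texture clause (d) forces almost-sure `7/10`-hard-core, so the nominal hard core `δ > 0` of clause (a) is idle. [folklore] -/
theorem periodicFrustratedLawGap_iff_sep07 :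
    Summit.AtomisticToContinuum.Crystallization.Theses.FrustratedLawDichotomy.PeriodicFrustratedLawGap ↔
    (∀ P : MeasureTheory.Measure (MeasureTheory.Measure (EuclideanSpace ℝ (Fin 3))), let Gy : ℝ → (N : ℕ) → (Fin N → EuclideanSpace ℝ (Fin 3)) → Fin N → Prop := fun η N y j => let d : ℝ := sInf ((fun z => dist z (y (j : Fin N))) '' (Set.range (y) \ {(y (j : Fin N))})); let T : Set (EuclideanSpace ℝ (Fin 3)) := {z : EuclideanSpace ℝ (Fin 3) | z ∈ Set.range (y) ∧ z ≠ (y (j : Fin N)) ∧ dist z (y (j : Fin N)) < 13 / 10 * d}; ∃ A : EuclideanSpace ℝ (Fin 3) →ₗᵢ[ℝ] EuclideanSpace ℝ (Fin 3), (∃ e : ↥T ≃ ↥Literature.Geometry.DiscreteGeometry.fccKissingPattern, ∀ t : ↥T, dist (d⁻¹ • ((t : EuclideanSpace ℝ (Fin 3)) - (y (j : Fin N)))) (A ((e t : ↥Literature.Geometry.DiscreteGeometry.fccKissingPattern) : EuclideanSpace ℝ (Fin 3))) ≤ η) ∨ (∃ e : ↥T ≃ ↥Literature.Geometry.DiscreteGeometry.hcpKissingPattern,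 ∀ t : ↥T, dist (d⁻¹ • ((t : EuclideanSpace ℝ (Fin 3)) - (y (j : Fin N)))) (A ((e t : ↥Literature.Geometry.DiscreteGeometry.hcpKissingPattern) : EuclideanSpace ℝ (Fin 3))) ≤ η); let TexBall : (N : ℕ) → (Fin N → EuclideanSpace ℝ (Fin 3)) → Fin N → ℝ → ℝ → ℝ → ℝ → Prop := fun N y i R R₇ R₈ R₉ => (∀ a b : Fin N, a ≠ b → (7 : ℝ) / 10 ≤ dist (y a) (y b)) ∧ (∀ j : Fin N, dist (y j) (y i) ≤ R → ¬ Gy (1 / 20) N (y) j) ∧ (∀ j : Fin N, dist (y j) (y i) ≤ R → ¬ ((∀ j' : Fin N, dist (y j') (y j) ≤ R₇ → ¬ Gy (1 / 20) N (y) j') ∧ (∀ z : EuclideanSpace ℝ (Fin 3), dist z (y j) ≤ R₇ → ∃ k : Fin N, dist z (y k) ≤ 1) ∧ (∀ j' : Fin N, dist (y j') (y j) ≤ R₇ → (let d : ℝ := sInf ((fun z => dist z (y j')) '' (Set.range (y) \ {(y j')})); ∀ k : Fin N, y k ≠ y j' → dist (y k) (y j') < 27 / 20 * d → 5 ≤ Nat.card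 {m : Fin N // y m ≠ y j' ∧ dist (y m) (y j') < 27 / 20 * d ∧ y m ≠ y k ∧ dist (y m) (y k) < 27 / 20 * d})))) ∧ (∀ j : Fin N, dist (y j) (y i) ≤ R → ∃ k : Fin N, dist (y k) (y j) ≤ R₈ ∧ Gy (1 / 8) N (y) k) ∧ (∀ j : Fin N, dist (y j) (y i) ≤ R → ¬ ((∀ j' : Fin N, dist (y j') (y j) ≤ R₉ → ¬ Gy (1 / 20) N (y) j') ∧ (Nat.card {j' : Fin N // dist (y j') (y j) ≤ R₉ ∧ ¬ Gy (1 / 8) N (y) j'} : ℝ) ≤ 1 / 2 * (Nat.card {j' : Fin N // dist (y j') (y j) ≤ R₉} : ℝ) ∧ (∀ j' : Fin N, dist (y j') (y j) ≤ R₉ → ¬ Gy (1 / 8) N (y) j' → ¬ (let d : ℝ := sInf ((fun z => dist z (y j')) '' (Set.range (y) \ {(y j')})); ∀ k : Fin N, y k ≠ y j' → dist (y k) (y j') < 27 / 20 * d → 5 ≤ Nat.card {m : Fin N // y m ≠ y j' ∧ dist (y m) (y j') < 27 / 20 * d ∧ y m ≠ y k ∧ dist (y m) (y k) < 27 / 20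 * d})))); let Appr : MeasureTheory.Measure (EuclideanSpace ℝ (Fin 3)) → ℝ → ℝ → ℝ → Prop := fun μ R₇ R₈ R₉ => ∀ q : EuclideanSpace ℝ (Fin 3), μ {q} ≠ 0 → ∀ R ε : ℝ, 0 < ε → ∃ (N : ℕ) (y : Fin N → EuclideanSpace ℝ (Fin 3)) (i : Fin N), TexBall N y i R R₇ R₈ R₉ ∧ (∀ p : EuclideanSpace ℝ (Fin 3), μ {p} ≠ 0 → dist p q ≤ R → ∃ k : Fin N, dist (y k - y i) (p - q) ≤ ε) ∧ (∀ k : Fin N, dist (y k) (y i) ≤ R → ∃ p : EuclideanSpace ℝ (Fin 3), μ {p} ≠ 0 ∧ dist (y k - y i) (p - q) ≤ ε); MeasureTheory.IsProbabilityMeasure P → (∀ᵐ μ ∂P, Literature.Probability.Process.IsRootedHardCore (7 / 10) μ) → Literature.Probability.Process.IsPointStationaryLaw P → (∃ R₇ R₈ R₉ : ℝ, ∀ᵐ μ ∂P, Appr μ R₇ R₈ R₉) → (∀ᵐ μ ∂P, ∀ p : EuclideanSpace ℝ (Fin 3), μ {p} ≠ 0 → ∀ y : EuclideanSpace ℝ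 (Fin 3), (∀ q : EuclideanSpace ℝ (Fin 3), μ {q} ≠ 0 → q ≠ p → y ≠ q) → ∑' q : {q : EuclideanSpace ℝ (Fin 3) // μ {q} ≠ 0 ∧ q ≠ p}, Literature.MathematicalPhysics.StatisticalMechanics.lennardJones (dist p (q : EuclideanSpace ℝ (Fin 3))) ≤ ∑' q : {q : EuclideanSpace ℝ (Fin 3) // μ {q} ≠ 0 ∧ q ≠ p}, Literature.MathematicalPhysics.StatisticalMechanics.lennardJones (dist y (q : EuclideanSpace ℝ (Fin 3)))) → 0 < P {μ : MeasureTheory.Measure (EuclideanSpace ℝ (Fin 3)) | ∃ Q : Literature.MathematicalPhysics.StatisticalMechanics.PeriodicConfiguration 3, ∃ t : EuclideanSpace ℝ (Fin 3), {p : EuclideanSpace ℝ (Fin 3) | μ {p} ≠ 0} = (fun s => s + t) '' Q.points} → (⨅ Q : Literature.MathematicalPhysics.StatisticalMechanics.PeriodicConfiguration 3, Q.energyPerParticle Literature.MathematicalPhysics.StatisticalMechanics.lennardJones) < (∫ μ, Literature.MathematicalPhysics.StatisticalMechanics.rootEnergy Literature.MathematicalPhysics.StatisticalMechanics.lennardJones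 μ ∂P)) := by
  constructor
  · intro h P
    have h' := h (7 / 10) (by norm_num) P
    dsimp only at h' ⊢
    exact h'
  · intro h δ _hδ P
    have h' := h P
    dsimp only at h' ⊢
    intro hP ha hb hd he h0
    refine h' hP ?_ hb hd he h0
    obtain ⟨R₇, R₈, R₉, hd'⟩ := hd
    refine ae_isRootedHardCore_upgrade ha ?_
    filter_upwards [hd'] with μ hμ q hq R ε hε
    obtain ⟨N, y, i, ⟨hsep, -⟩, hm, -⟩ := hμ q hq R ε hε
    exact ⟨N, y, i, hsep, hm⟩

/-- **Equilibrium cut for Φper.**  `PeriodicFrustratedLawGap` (BY NAME) is EQUIVALENT to its restriction to the single hard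
core `δ = 7/10` and to laws almost surely in FORCE BALANCE and LOCALLY STABLE (nonnegative Laplacian sum; a neighbour within
`(11/5)^{1/6}` of every atom not alone) at every atom — consequences of clauses (a), (d), (e). [folklore] -/
theorem periodicFrustratedLawGap_iff_equilibrium :
    Summit.AtomisticToContinuum.Crystallization.Theses.FrustratedLawDichotomy.PeriodicFrustratedLawGap ↔
    (∀ P : MeasureTheory.Measure (MeasureTheory.Measure (EuclideanSpace ℝ (Fin 3))), let Gy : ℝ → (N : ℕ) → (Fin N → EuclideanSpace ℝ (Fin 3)) → Fin N → Prop := fun η N y j => let d : ℝ := sInf ((fun z => dist z (y (j : Fin N))) '' (Set.range (y) \ {(y (j : Fin N))})); let T : Set (EuclideanSpace ℝ (Fin 3)) := {z : EuclideanSpace ℝ (Fin 3) | z ∈ Set.range (y) ∧ z ≠ (y (j : Fin N)) ∧ dist z (y (j : Fin N)) < 13 / 10 * d}; ∃ A : EuclideanSpace ℝ (Fin 3) →ₗᵢ[ℝ] EuclideanSpace ℝ (Fin 3), (∃ e : ↥T ≃ ↥Literature.Geometry.DiscreteGeometry.fccKissingPattern, ∀ t : ↥T, dist (d⁻¹ •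 ((t : EuclideanSpace ℝ (Fin 3)) - (y (j : Fin N)))) (A ((e t : ↥Literature.Geometry.DiscreteGeometry.fccKissingPattern) : EuclideanSpace ℝ (Fin 3))) ≤ η) ∨ (∃ e : ↥T ≃ ↥Literature.Geometry.DiscreteGeometry.hcpKissingPattern, ∀ t : ↥T, dist (d⁻¹ • ((t : EuclideanSpace ℝ (Fin 3)) - (y (j : Fin N)))) (A ((e t : ↥Literature.Geometry.DiscreteGeometry.hcpKissingPattern) : EuclideanSpace ℝ (Fin 3))) ≤ η); let TexBall : (N : ℕ) → (Fin N → EuclideanSpace ℝ (Fin 3)) → Fin N → ℝ → ℝ → ℝ → ℝ → Prop := fun N y i R R₇ R₈ R₉ => (∀ a b : Fin N, a ≠ b → (7 : ℝ) / 10 ≤ dist (y a) (y b)) ∧ (∀ j : Fin N, dist (y j) (y i) ≤ R → ¬ Gy (1 / 20) N (y) j) ∧ (∀ j : Fin N, dist (y j) (y i) ≤ R → ¬ ((∀ j' : Fin N, dist (y j') (y j) ≤ R₇ → ¬ Gy (1 / 20) N (y) j') ∧ (∀ z : EuclideanSpace ℝ (Fin 3), dist z (y j) ≤ R₇ → ∃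 k : Fin N, dist z (y k) ≤ 1) ∧ (∀ j' : Fin N, dist (y j') (y j) ≤ R₇ → (let d : ℝ := sInf ((fun z => dist z (y j')) '' (Set.range (y) \ {(y j')})); ∀ k : Fin N, y k ≠ y j' → dist (y k) (y j') < 27 / 20 * d → 5 ≤ Nat.card {m : Fin N // y m ≠ y j' ∧ dist (y m) (y j') < 27 / 20 * d ∧ y m ≠ y k ∧ dist (y m) (y k) < 27 / 20 * d})))) ∧ (∀ j : Fin N, dist (y j) (y i) ≤ R → ∃ k : Fin N, dist (y k) (y j) ≤ R₈ ∧ Gy (1 / 8) N (y) k) ∧ (∀ j : Fin N, dist (y j) (y i) ≤ R → ¬ ((∀ j' : Fin N, dist (y j') (y j) ≤ R₉ → ¬ Gy (1 / 20) N (y) j') ∧ (Nat.card {j' : Fin N // dist (y j') (y j) ≤ R₉ ∧ ¬ Gy (1 / 8) N (y) j'} : ℝ) ≤ 1 / 2 * (Nat.card {j' : Fin N // dist (y j') (y j) ≤ R₉} : ℝ) ∧ (∀ j' : Fin N, dist (y j') (y j) ≤ R₉ → ¬ Gy (1 / 8) N (y) j' → ¬ (let d : ℝ := sInf ((fun z =>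 dist z (y j')) '' (Set.range (y) \ {(y j')})); ∀ k : Fin N, y k ≠ y j' → dist (y k) (y j') < 27 / 20 * d → 5 ≤ Nat.card {m : Fin N // y m ≠ y j' ∧ dist (y m) (y j') < 27 / 20 * d ∧ y m ≠ y k ∧ dist (y m) (y k) < 27 / 20 * d})))); let Appr : MeasureTheory.Measure (EuclideanSpace ℝ (Fin 3)) → ℝ → ℝ → ℝ → Prop := fun μ R₇ R₈ R₉ => ∀ q : EuclideanSpace ℝ (Fin 3), μ {q} ≠ 0 → ∀ R ε : ℝ, 0 < ε → ∃ (N : ℕ) (y : Fin N → EuclideanSpace ℝ (Fin 3)) (i : Fin N), TexBall N y i R R₇ R₈ R₉ ∧ (∀ p : EuclideanSpace ℝ (Fin 3), μ {p} ≠ 0 → dist p q ≤ R → ∃ k : Fin N, dist (y k - y i) (p - q) ≤ ε) ∧ (∀ k : Fin N, dist (y k) (y i) ≤ R → ∃ p : EuclideanSpace ℝ (Fin 3), μ {p} ≠ 0 ∧ dist (y k - y i) (p - q) ≤ ε); MeasureTheory.IsProbabilityMeasure P → (∀ᵐ μ ∂P, Literature.Probability.Process.IsRootedHardCore (7 / 10)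 μ) → Literature.Probability.Process.IsPointStationaryLaw P → (∃ R₇ R₈ R₉ : ℝ, ∀ᵐ μ ∂P, Appr μ R₇ R₈ R₉) → (∀ᵐ μ ∂P, ∀ p : EuclideanSpace ℝ (Fin 3), μ {p} ≠ 0 → ∀ y : EuclideanSpace ℝ (Fin 3), (∀ q : EuclideanSpace ℝ (Fin 3), μ {q} ≠ 0 → q ≠ p → y ≠ q) → ∑' q : {q : EuclideanSpace ℝ (Fin 3) // μ {q} ≠ 0 ∧ q ≠ p}, Literature.MathematicalPhysics.StatisticalMechanics.lennardJones (dist p (q : EuclideanSpace ℝ (Fin 3))) ≤ ∑' q : {q : EuclideanSpace ℝ (Fin 3) // μ {q} ≠ 0 ∧ q ≠ p}, Literature.MathematicalPhysics.StatisticalMechanics.lennardJones (dist y (q : EuclideanSpace ℝ (Fin 3)))) → (∀ᵐ μ ∂P, ∀ p : EuclideanSpace ℝ (Fin 3), μ {p} ≠ 0 → HasSum (fun q : {q : EuclideanSpace ℝ (Fin 3) // μ {q} ≠ 0 ∧ q ≠ p} => ((dist p (q : EuclideanSpace ℝ (Fin 3)))⁻¹ ^ 8 - (dist p (q : EuclideanSpace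 ℝ (Fin 3)))⁻¹ ^ 14) • (p - (q : EuclideanSpace ℝ (Fin 3)))) 0 ∧ (∃ L : ℝ, 0 ≤ L ∧ HasSum (fun q : {q : EuclideanSpace ℝ (Fin 3) // μ {q} ≠ 0 ∧ q ≠ p} => 11 * (dist p (q : EuclideanSpace ℝ (Fin 3)))⁻¹ ^ 14 - 5 * (dist p (q : EuclideanSpace ℝ (Fin 3)))⁻¹ ^ 8) L) ∧ ((∃ q : EuclideanSpace ℝ (Fin 3), μ {q} ≠ 0 ∧ q ≠ p) → ∃ q : EuclideanSpace ℝ (Fin 3), μ {q} ≠ 0 ∧ q ≠ p ∧ dist p q ^ 6 ≤ 11 / 5)) → 0 < P {μ : MeasureTheory.Measure (EuclideanSpace ℝ (Fin 3)) | ∃ Q : Literature.MathematicalPhysics.StatisticalMechanics.PeriodicConfiguration 3, ∃ t : EuclideanSpace ℝ (Fin 3), {p : EuclideanSpace ℝ (Fin 3) | μ {p} ≠ 0} = (fun s => s + t) '' Q.points} → (⨅ Q : Literature.MathematicalPhysics.StatisticalMechanics.PeriodicConfiguration 3, Q.energyPerParticle Literature.MathematicalPhysics.StatisticalMechanics.lennardJones)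 < (∫ μ, Literature.MathematicalPhysics.StatisticalMechanics.rootEnergy Literature.MathematicalPhysics.StatisticalMechanics.lennardJones μ ∂P)) := by
  rw [periodicFrustratedLawGap_iff_sep07]
  constructor
  · intro h P
    have h' := h P
    dsimp only at h' ⊢
    intro hP ha hb hd he _heq h0
    exact h' hP ha hb hd he h0
  · intro h P
    have h' := h P
    dsimp only at h' ⊢
    intro hP ha hb hd he h0
    refine h' hP ha hb hd he ?_ h0
    filter_upwards [ae_forceBalance_of_nash (by norm_num) ha he, ae_laplacian_nonneg_of_nash (by norm_num) ha he,
      ae_exists_near_of_nash (by norm_num) ha he] with μ h₀ h₁ h₂ p hp using ⟨h₀ p hp, h₁ p hp, h₂ p hp⟩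

end Summit.AtomisticToContinuum.Crystallization.Theorems.FrustratedLawDichotomyPeriodicGapEquilibriumCut

end
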